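import Summits.QuantumFields.BalabanUV.Beta.EriceRemainderEnclosureHistoryAutonomyFunctionalShiftLargeLimit
import Summits.QuantumFields.BalabanUV.Beta.EriceRemainderEnclosureHistoryAutonomyFunctionalShiftEnd

/-!
# EriceRemainderEnclosureHistoryAutonomyFunctionalShiftLargeEnd — (E52d) THE ENDs OF THE NO-SMALLNESS STATION: under node U2's binder list for a history family
# `β` (`InjectedRate`, `ScaleShiftRate`, `HistLipschitz Λ` with rows `Σ_i Λ k i ≤ M` OF ANY SIZE, `EventualLowerH b`) — NO sharp-regime smallness — and a second
# family `βt` (its own `InjectedRate` ∕ `ScaleShiftRate` ∕ `HistLipschitz`, the same eventual floor `b`) that is `ρ(a)`-close to `β` on the sub-box histories, the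
# continuum running couplings `g⋆`, `g̃⋆` of two lattice families of runs pinned at TWO infrared values `g_IR, g̃_IR ≤ P ≤ γ` satisfy, for every `m₀ ≥ max(6,
# 4M²∕(27b³))`: `|1∕(g⋆_m)² − 1∕(g̃⋆_m)²| ≤ 2e^{6M∕(b√b)}·(|1∕g_IR² − 1∕g̃_IR²| + 2M√m₀∕√b + Σ_{l<m} ρ(c_{l+1}))`, `c_i = (1∕P² + i·b)^{−1∕2}`; if `Σ_l ρ(c_{l+1}) < ∞`
# the level difference CONVERGES; and for ONE history family (`βt = β`) pinned at two infrared values THE RELATIVE Λ-PARAMETER `lim_m (1∕(g⋆_m)² − 1∕(g⋆′_m)²)`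
# EXISTS (rate `m^{−1∕2}` in (E52f)) — the continuum trajectory is determined by its infrared datum UP TO an asymptotically constant level shift, for memory of any size

Cell `pub-balaban`, β-function sub-cell, BINDER row D4 «RemainderConst leaves for Bałaban's split» (`HOME/BINDER-OWNERS.md`; owner lineage `b2b-balaban-beta-an4`;
this file by co-owner #2 lineage `b2b-balaban-beta-d4-p2`, generation 48), β-FLOW TEAM duty (1), FREEZE (0) honoured (def-free; node U2's `betaInf` ∕ `tendsto_invSq` ∕
`le_betaInf_of_eventualLower`, (E37a)'s `memFlow_gstar_of_injectedRate` ∕ `seqBox_gstar_of_tendsto`, (E37c)'s `zerothMoment_betaInf_of_rows` ∕ `rowBound_nonneg`,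
(E51d)'s `abs_betaInf_sub_le_on_subbox`, (E52b)'s `threshold_scale_of_le` ∕ `abs_disc_le_large`, (E52c)'s `exists_tendsto_disc_large` ∕ `exists_tendsto_disc_large_init`
BY NAME, nothing restated; the binder lists are HYPOTHESES — NOT PRINTED (GAPS G-t4-U2-1∕-2), never facts).  Parallel to (E51d) `…FunctionalShiftEnd` (one pin, the
simplified sharp regime `M·γ ≤ (3√3∕2)·b`, `M·γ³ ≤ 1∕2`); here: two pins, rows of ANY size.

HONEST FRAMING (page 1, verbatim and binding).  *"Discharging BetaPertH makes Bałaban's UV stability UNCONDITIONAL — a real constructive-QFT result; it is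
NOT the continuum limit and NOT the Clay problem."*  THIS FILE DISCHARGES NOTHING OF THE KIND.  It composes [folklore] real analysis over node U2's typed
HYPOTHESIS SHAPES on ABSTRACT families `β, βt : FlowStep.HBeta`; the sub-box closeness `|β k v − βt k v| ≤ ρ(a)` is a displayed binder of the SHAPE of a
remainder bound — that Bałaban's `β_k` of [I] (1.22) and its one-loop part stand in such a relation with a given profile is row D4's OPEN discharge
(`RemainderConst`: `ρ ≡ r`) or NOT PRINTED (finer profiles), and is not asserted; the size of the rows of Bałaban's history modulus is NOT PRINTED either ([I]
p. 298 qualitative) — which is why this END drops the smallness.  Row D4 class UNCHANGED (critical-path width 0; instance 0∕1; D4 DISCHARGE NO DATE).  HONEST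
DEPENDENCY: continuum YM on T⁴ ⇐ BetaPertH ∧ nine spine estimates (0/9 proved); BetaPertH ⇐ (D1) ∧ (D4) ∧ CAP+tail; G-an2-4 gates asym, D1 and NE2/3/4.

THE POINT (census sense (α)).  (E51d) needed the simplified sharp regime and one infrared pin.  With (E52b)∕(E52c) both restrictions go: the continuum
running couplings of two lattice regularisations whose β-functionals are `ρ`-close on sub-boxes, renormalised at two infrared values, have levels within
`2e^{6M∕(b√b)}·(|1∕g_IR² − 1∕g̃_IR²| + 2M√m₀∕√b + Σ_{l<m} ρ(c_{l+1}))` of each other at every physical scale, for rows `M` of ANY size (§1); a summable profile is a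
finite Λ-shift (§2); and ONE regularisation renormalised at two infrared values has a RELATIVE Λ-PARAMETER (§3) — in textbook words, the integration constant of
the renormalization-group equation is the only freedom left once the β-functional is fixed, here for a flow WITH MEMORY of any size and without assuming that the
flow determines its trajectory (uniqueness can fail above `3√3`, (E38c); the continuum couplings are whatever limits the lattice families produce).  AS-PRINTED:
nothing — `BetaFlowAsPrinted` records a Markov `β_n` and a pointwise limit claim (DELTA D-11).

WHAT IS PROVED ([folklore]; 0 `def`, 0 sorry).  §1 **`abs_invSq_gstar_sub_le_large`** (the level-shift END, two pins, any `M`).  §2 **`exists_tendsto_invSq_gstar_sub_large`**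
(summable profile ⟹ the continuum level difference converges, any `M`).  §3 **`exists_relativeLambda_of_injectedRate`** (one history family, two infrared pins: the
relative Λ-parameter exists, with its bound).
-/

noncomputable section
open Filter Topology Finset

namespace Summit.QuantumFields.BalabanUV.Beta.EriceRemainderEnclosureHistoryAutonomyFunctionalShiftLargeEnd

open Literature.MathematicalPhysics.QuantumFieldTheory.Balaban1983to89
open Literature.MathematicalPhysics.QuantumFieldTheory.Balaban1983to89.FlowStep
open Literature.MathematicalPhysics.QuantumFieldTheory.Balaban1983to89.T4CouplingMatching
open Literature.MathematicalPhysics.QuantumFieldTheory.Balaban1983to89.T4CauchySum (InjectedRate)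
open Literature.MathematicalPhysics.QuantumFieldTheory.Balaban1983to89.T4ContinuumCoupling
open Literature.MathematicalPhysics.QuantumFieldTheory.Balaban1983to89.T4BetaStationary
open Literature.MathematicalPhysics.QuantumFieldTheory.Balaban1983to89.T4BetaFlowWellPosed (MemFlow)
open Summit.QuantumFields.BalabanUV.Beta.EriceRemainderEnclosureHistoryAutonomy
open Summit.QuantumFields.BalabanUV.Beta.EriceRemainderEnclosureHistoryAutonomyEnd
open Summit.QuantumFields.BalabanUV.Beta.EriceRemainderEnclosureHistoryAutonomyFunctionalShiftEnd (abs_betaInf_sub_le_on_subbox)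
open Summit.QuantumFields.BalabanUV.Beta.EriceRemainderEnclosureHistoryAutonomyFunctionalShiftLarge
open Summit.QuantumFields.BalabanUV.Beta.EriceRemainderEnclosureHistoryAutonomyFunctionalShiftLargeLimit

variable {β βt : HBeta} {γ c θs ct θst : ℝ} {Λ Λt : ℕ → ℕ → ℝ} {M P : ℝ} {ρ : ℝ → ℝ}
variable {g gt : ℕ → ℕ → ℝ} {gIR gIRt C θ₁ Ct θt b : ℝ} {k₀ k₀t : ℕ}

/-! ## §1 The level shift between the continuum running couplings of two lattice families — two pins, rows of any size -/

/-- **THE LEVEL SHIFT BETWEEN TWO CONTINUUM RUNNING COUPLINGS — NO SMALLNESS, TWO INFRARED PINS.**  `β` under node U2's binder list (`ScaleShiftRate c θs γ β`,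
`HistLipschitz Λ γ β` with `Λ ≥ 0` and rows `Σ_{i≤k} Λ k i ≤ M` of ANY size, `EventualLowerH b γ k₀ β`, `b > 0`); a SECOND family `βt` with `ScaleShiftRate`,
`HistLipschitz Λt` (ANY `Λt` — continuity only), the same eventual floor `EventualLowerH b γ k₀t βt`, and `ρ(a)`-close to `β` on the sub-box histories; lattice
families `g` (runs of `β`, `InjectedRate C 0 θ₁`, pinned at `g_IR`) and `gt` (runs of `βt`, `InjectedRate Ct 0 θt`, pinned at `g̃_IR`) in the box, `g_IR, g̃_IR ≤ P ≤ γ`;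
`m₀ ≥ 6` with `4M²∕(27b³) ≤ m₀`.  Then at EVERY physical scale
`|1∕(g⋆_m)² − 1∕(g̃⋆_m)²| ≤ 2e^{6M∕(b√b)}·(|1∕g_IR² − 1∕g̃_IR²| + 2M√m₀∕√b + Σ_{l<m} ρ((1∕P² + (l+1)·b)^{−1∕2}))`.  Binders NOT PRINTED, never facts. [folklore] -/
theorem abs_invSq_gstar_sub_le_large (hθ1 : θ₁ < 1) (hinj : InjectedRate C 0 θ₁ (fun K j => disc (g K) (g (K + 1)) j))
    (hbox : ∀ K i, i ≤ K → 0 < g K i ∧ g K i ≤ γ) (hrun : ∀ K, RGEqH K β (g K)) (hpin : ∀ K, g K K = gIR)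
    (hθt1 : θt < 1) (hinjt : InjectedRate Ct 0 θt (fun K j => disc (gt K) (gt (K + 1)) j))
    (hboxt : ∀ K i, i ≤ K → 0 < gt K i ∧ gt K i ≤ γ) (hrunt : ∀ K, RGEqH K βt (gt K)) (hpint : ∀ K, gt K K = gIRt)
    (hP : gIR ≤ P) (hPt : gIRt ≤ P) (hPγ : P ≤ γ)
    (hss : ScaleShiftRate c θs γ β) (hL : HistLipschitz Λ γ β) (hΛ : ∀ k i, i ≤ k → 0 ≤ Λ k i)
    (hrow : ∀ k, ∑ i ∈ range (k + 1), Λ k i ≤ M) (hθs0 : 0 ≤ θs) (hθs1 : θs < 1) (hev : EventualLowerH b γ k₀ β) (hb : 0 < b)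
    (hsst : ScaleShiftRate ct θst γ βt) (hLt : HistLipschitz Λt γ βt) (hθst0 : 0 ≤ θst) (hθst1 : θst < 1)
    (hevt : EventualLowerH b γ k₀t βt)
    (hlat : ∀ a : ℝ, 0 < a → a ≤ γ → ∀ k v, v ∈ Box a k → |β k v - βt k v| ≤ ρ a)
    {m₀ : ℕ} (h6 : 6 ≤ m₀) (hm₀ : 4 * M ^ 2 / (27 * b ^ 3) ≤ m₀) (m : ℕ) :
    |1 / gstar g m ^ 2 - 1 / gstar gt m ^ 2|
      ≤ 2 * Real.exp (6 * M / (b * Real.sqrt b))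
        * (|1 / gIR ^ 2 - 1 / gIRt ^ 2| + 2 * M * Real.sqrt (m₀ : ℝ) / Real.sqrt b
            + ∑ l ∈ range m, ρ (1 / Real.sqrt (1 / P ^ 2 + ((l : ℝ) + 1) * b))) := by
  have hgIR : 0 < gIR := by rw [← hpin 0]; exact (hbox 0 0 le_rfl).1
  have hgIRt : 0 < gIRt := by rw [← hpint 0]; exact (hboxt 0 0 le_rfl).1
  have hM : 0 ≤ M := rowBound_nonneg hΛ hrow
  have hconv : ∀ m, Tendsto (invSq g m) atTop (𝓝 (astar g m)) := fun m => tendsto_invSq hθ1 hinj m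
  have hconvt : ∀ m, Tendsto (invSq gt m) atTop (𝓝 (astar gt m)) := fun m => tendsto_invSq hθt1 hinjt m
  obtain ⟨hq, hK⟩ := threshold_scale_of_le hb hM P h6 hm₀
  exact abs_disc_le_large (zerothMoment_betaInf_of_rows hss hθs1 hL hΛ hrow) hM hgIR hP hgIRt hPt hPγ hb
    (fun u hu => le_betaInf_of_eventualLower hss hθs1 hev hu) (fun u hu => le_betaInf_of_eventualLower hsst hθst1 hevt hu)
    (abs_betaInf_sub_le_on_subbox hss hθs1 hsst hθst1 hlat) (seqBox_gstar_of_tendsto hbox hconv) (seqBox_gstar_of_tendsto hboxt hconvt)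
    (memFlow_gstar_of_injectedRate hθ1 hinj hbox hrun hpin hss hL hθs0 hθs1)
    (memFlow_gstar_of_injectedRate hθt1 hinjt hboxt hrunt hpint hsst hLt hθst0 hθst1) hq hK m

/-! ## §2 A summable lattice perturbation is a finite Λ-shift of the continuum running coupling — any `M`, two pins -/

/-- **A SUMMABLE LATTICE PERTURBATION IS A FINITE Λ-SHIFT — NO SMALLNESS, TWO INFRARED PINS**: under the binders of `abs_invSq_gstar_sub_le_large`, if
`Σ_{l≥0} ρ((1∕P² + (l+1)·b)^{−1∕2})` converges then `1∕(g⋆_m)² − 1∕(g̃⋆_m)²` CONVERGES as `m → ∞`, to some `δ_∞` with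
`|δ_∞| ≤ 2e^{6M∕(b√b)}·(|1∕g_IR² − 1∕g̃_IR²| + 2M√m₀∕√b + Σ_{l≥0} ρ(c_{l+1}))`. [folklore] -/
theorem exists_tendsto_invSq_gstar_sub_large (hθ1 : θ₁ < 1) (hinj : InjectedRate C 0 θ₁ (fun K j => disc (g K) (g (K + 1)) j))
    (hbox : ∀ K i, i ≤ K → 0 < g K i ∧ g K i ≤ γ) (hrun : ∀ K, RGEqH K β (g K)) (hpin : ∀ K, g K K = gIR)
    (hθt1 : θt < 1) (hinjt : InjectedRate Ct 0 θt (fun K j => disc (gt K) (gt (K + 1)) j))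
    (hboxt : ∀ K i, i ≤ K → 0 < gt K i ∧ gt K i ≤ γ) (hrunt : ∀ K, RGEqH K βt (gt K)) (hpint : ∀ K, gt K K = gIRt)
    (hP : gIR ≤ P) (hPt : gIRt ≤ P) (hPγ : P ≤ γ)
    (hss : ScaleShiftRate c θs γ β) (hL : HistLipschitz Λ γ β) (hΛ : ∀ k i, i ≤ k → 0 ≤ Λ k i)
    (hrow : ∀ k, ∑ i ∈ range (k + 1), Λ k i ≤ M) (hθs0 : 0 ≤ θs) (hθs1 : θs < 1) (hev : EventualLowerH b γ k₀ β) (hb : 0 < b)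
    (hsst : ScaleShiftRate ct θst γ βt) (hLt : HistLipschitz Λt γ βt) (hθst0 : 0 ≤ θst) (hθst1 : θst < 1)
    (hevt : EventualLowerH b γ k₀t βt)
    (hlat : ∀ a : ℝ, 0 < a → a ≤ γ → ∀ k v, v ∈ Box a k → |β k v - βt k v| ≤ ρ a)
    (hsum : Summable fun l : ℕ => ρ (1 / Real.sqrt (1 / P ^ 2 + ((l : ℝ) + 1) * b)))
    {m₀ : ℕ} (h6 : 6 ≤ m₀) (hm₀ : 4 * M ^ 2 / (27 * b ^ 3) ≤ m₀) :
    ∃ δ : ℝ, Tendsto (fun m => 1 / gstar g m ^ 2 - 1 / gstar gt m ^ 2) atTop (𝓝 δ)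
      ∧ |δ| ≤ 2 * Real.exp (6 * M / (b * Real.sqrt b))
          * (|1 / gIR ^ 2 - 1 / gIRt ^ 2| + 2 * M * Real.sqrt (m₀ : ℝ) / Real.sqrt b
              + ∑' l : ℕ, ρ (1 / Real.sqrt (1 / P ^ 2 + ((l : ℝ) + 1) * b))) := by
  have hgIR : 0 < gIR := by rw [← hpin 0]; exact (hbox 0 0 le_rfl).1
  have hgIRt : 0 < gIRt := by rw [← hpint 0]; exact (hboxt 0 0 le_rfl).1
  have hM : 0 ≤ M := rowBound_nonneg hΛ hrow
  have hconv : ∀ m, Tendsto (invSq g m) atTop (𝓝 (astar g m)) := fun m => tendsto_invSq hθ1 hinj m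
  have hconvt : ∀ m, Tendsto (invSq gt m) atTop (𝓝 (astar gt m)) := fun m => tendsto_invSq hθt1 hinjt m
  obtain ⟨hq, hK⟩ := threshold_scale_of_le hb hM P h6 hm₀
  exact exists_tendsto_disc_large (zerothMoment_betaInf_of_rows hss hθs1 hL hΛ hrow) hM hgIR hP hgIRt hPt hPγ hb
    (fun u hu => le_betaInf_of_eventualLower hss hθs1 hev hu) (fun u hu => le_betaInf_of_eventualLower hsst hθst1 hevt hu)
    (abs_betaInf_sub_le_on_subbox hss hθs1 hsst hθst1 hlat) hsum (seqBox_gstar_of_tendsto hbox hconv) (seqBox_gstar_of_tendsto hboxt hconvt)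
    (memFlow_gstar_of_injectedRate hθ1 hinj hbox hrun hpin hss hL hθs0 hθs1)
    (memFlow_gstar_of_injectedRate hθt1 hinjt hboxt hrunt hpint hsst hLt hθst0 hθst1) hq hK

/-! ## §3 One history family, two infrared pins: the relative Λ-parameter of the continuum running coupling -/

/-- **THE RELATIVE Λ-PARAMETER OF ONE REGULARISATION RENORMALISED AT TWO INFRARED VALUES.**  `β` under node U2's binder list (`ScaleShiftRate`, `HistLipschitz Λ`
with `Λ ≥ 0` and rows `≤ M` of ANY size, `EventualLowerH b`, `b > 0`); two lattice families `g, g′` of runs of the SAME `β` in the box ]0,γ] with `InjectedRate` (each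
its own constants), pinned at `g_IR` and `g_IR′`; `m₀ ≥ max(6, 4M²∕(27b³))`.  Then the continuum running couplings `g⋆ = gstar g`, `g⋆′ = gstar g′` have a
CONVERGENT level offset: `1∕(g⋆_m)² − 1∕(g⋆′_m)² → δ_∞` with `|δ_∞| ≤ 2e^{6M∕(b√b)}·(|1∕g_IR² − 1∕g_IR′²| + 2M√m₀∕√b)` (rate `m^{−1∕2}`: (E52f)
`…FunctionalShiftLargeRate.abs_disc_sub_lim_le_large_init`) — the infrared datum moves the continuum trajectory by an asymptotically CONSTANT level shift, for
memory of any size and without uniqueness of the memory flow. [folklore] -/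
theorem exists_relativeLambda_of_injectedRate {g' : ℕ → ℕ → ℝ} {gIR' C' θ' : ℝ}
    (hθ1 : θ₁ < 1) (hinj : InjectedRate C 0 θ₁ (fun K j => disc (g K) (g (K + 1)) j))
    (hbox : ∀ K i, i ≤ K → 0 < g K i ∧ g K i ≤ γ) (hrun : ∀ K, RGEqH K β (g K)) (hpin : ∀ K, g K K = gIR)
    (hθ1' : θ' < 1) (hinj' : InjectedRate C' 0 θ' (fun K j => disc (g' K) (g' (K + 1)) j))
    (hbox' : ∀ K i, i ≤ K → 0 < g' K i ∧ g' K i ≤ γ) (hrun' : ∀ K, RGEqH K β (g' K)) (hpin' : ∀ K, g' K K = gIR')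
    (hss : ScaleShiftRate c θs γ β) (hL : HistLipschitz Λ γ β) (hΛ : ∀ k i, i ≤ k → 0 ≤ Λ k i)
    (hrow : ∀ k, ∑ i ∈ range (k + 1), Λ k i ≤ M) (hθs0 : 0 ≤ θs) (hθs1 : θs < 1) (hev : EventualLowerH b γ k₀ β) (hb : 0 < b)
    {m₀ : ℕ} (h6 : 6 ≤ m₀) (hm₀ : 4 * M ^ 2 / (27 * b ^ 3) ≤ m₀) :
    ∃ δ : ℝ, Tendsto (fun m => 1 / gstar g m ^ 2 - 1 / gstar g' m ^ 2) atTop (𝓝 δ)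
      ∧ |δ| ≤ 2 * Real.exp (6 * M / (b * Real.sqrt b)) * (|1 / gIR ^ 2 - 1 / gIR' ^ 2| + 2 * M * Real.sqrt (m₀ : ℝ) / Real.sqrt b) := by
  have hgIR : 0 < gIR := by rw [← hpin 0]; exact (hbox 0 0 le_rfl).1
  have hgIRγ : gIR ≤ γ := by rw [← hpin 0]; exact (hbox 0 0 le_rfl).2
  have hgIR' : 0 < gIR' := by rw [← hpin' 0]; exact (hbox' 0 0 le_rfl).1
  have hgIRγ' : gIR' ≤ γ := by rw [← hpin' 0]; exact (hbox' 0 0 le_rfl).2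
  have hM : 0 ≤ M := rowBound_nonneg hΛ hrow
  have hconv : ∀ m, Tendsto (invSq g m) atTop (𝓝 (astar g m)) := fun m => tendsto_invSq hθ1 hinj m
  have hconv' : ∀ m, Tendsto (invSq g' m) atTop (𝓝 (astar g' m)) := fun m => tendsto_invSq hθ1' hinj' m
  obtain ⟨hq, hK⟩ := threshold_scale_of_le hb hM γ h6 hm₀
  exact exists_tendsto_disc_large_init (zerothMoment_betaInf_of_rows hss hθs1 hL hΛ hrow) hM hgIR hgIRγ hgIR' hgIRγ' hb
    (fun u hu => le_betaInf_of_eventualLower hss hθs1 hev hu) (seqBox_gstar_of_tendsto hbox hconv) (seqBox_gstar_of_tendsto hbox' hconv')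
    (memFlow_gstar_of_injectedRate hθ1 hinj hbox hrun hpin hss hL hθs0 hθs1)
    (memFlow_gstar_of_injectedRate hθ1' hinj' hbox' hrun' hpin' hss hL hθs0 hθs1) hq hK

end Summit.QuantumFields.BalabanUV.Beta.EriceRemainderEnclosureHistoryAutonomyFunctionalShiftLargeEnd

end
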